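/-
Copyright (c) 2026 the pub-hodgecm-mathlib formalisation cell (harness21).  Prover seat hodgecm-mathlib-K2E3-p12 (g8), Track B ∕ K2-LIT, h413 = `stmt-HodgeConjecture-24833`,
line `K2_E1_TraceFormulaBeta`, 5Res ROADCARD «ENDGAME BY FAMILIES» (K2E1-plan (g7), (154)) file C1 «f3-χ» (deal (142)), part W-b: the TWISTED pseudo-Eisenstein inner product pushed to
the IDELE CLASSES (★ D0 unfolding ∘ ★ hAVG ∘ ★ D0-χ constant term ∘ ★ (δ)₂ with the `χ`-section `K_U`-averages of ★ W-a) — letter-free; the idele class integral is left unevaluated.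
-/
import Summits.HodgeConjecture.HodgeConjecture.Theorems.K2E1ChiPseudoEisensteinRadialCMTwo          -- ★ D0-χ p859888 (this seat): θ_{f,ψ} bounded∕Borel∕G(F)-invariant, CT(θ_{f,ψ}), Mellin form; transitively ★ D0, ★ hAVG, ★ (δ)₂
import Summits.HodgeConjecture.HodgeConjecture.Theorems.K2E1ChiSectionTorusAverageU2                -- ★ W-a p859909 (this seat): `φ(t y) = χ(d₀ t)φ(y)`, `H(t k) = ‖d₀ t‖`, torus scaling of `I(z,·)` in `d₀`-currency
import Summits.HodgeConjecture.HodgeConjecture.Theorems.K2E1PseudoEisensteinInnerProductCMTwoFinal  -- ★ Final p859681 (this seat): `setLIntegral_inv_mul_inv_mul_enorm_lt_top`; transitively ★ C `setLIntegral_inv_ideleNorm_mul_comp_eq`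
import Literature.NumberTheory.Automorphic.UnitaryGroupBorelConstantTermInvariance                    -- ★ `borelConstantTerm_rational_borel_mul_of_rational_invariant`
import Literature.NumberTheory.Automorphic.UnitaryGroupUnipotentUnimodularThree                       -- ★ `borelConstantTerm_unipotent_mul_of_isMulRightInvariant`
import Literature.NumberTheory.Automorphic.UnitaryGroupLineUnipotentTwo                               -- ★ `isMulRightInvariant_of_isMulLeftInvariant_two`
import HarnessLib

/-!
# C1 «f3-χ», part W-b — `K2E1ChiPseudoEisensteinIdeleLevelCMTwo`: THE INNER PRODUCT OF TWO TWISTED PSEUDO-EISENSTEIN SERIES ON `U(1,1)_{L∕L⁺}` AS AN IDELE CLASS INTEGRAL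
# `⟨θ_{f,φ}, θ_{f′,φ′}⟩_X = C·∫_{𝓕_I} ‖x‖⁻¹ • Φ(x) dν_I`, `Φ(x) = ∫_{K_U} f(‖x‖)χ(x)φ(k)·conj( f′(‖x‖)χ′(x)φ′(k) + (ν𝓕)⁻¹•(2π)⁻¹∫_ℝ f̃′(z)·‖x‖χ′ʷ(x)(‖x‖⁻¹)^z·I_{φ′}(z,k) dy ) dμ_K` (letter-free)

Track B ∕ K2-LIT, crux h413 = `stmt-HodgeConjecture-24833`, route of record `HCCMUnconditional`; cell `hodgecm-mathlib`, squad K2, ENGINE E1.  THEOREMS ONLY (no `def`, no `instance`,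
no `notation`, no named-fact hypothesis, no `sorry`); lane `--supports stmt-HodgeConjecture-24833 --as helper` (count-neutral).
THE MATHEMATICS ([MoeglinWaldspurger1995, II.1.7, II.2.1]; [Rogawski1990, §7.3 pp. 96–98]; [GelbartRogawski1991, §3.1]; ROADCARD (154) §0–§1).  For `χ`-, `χ′`-sections `φ, φ′` of `U(J₂)(𝔸_{L⁺})`
(continuous, bounded: the finite-dimensional `chiSectionSpace` data), `f, f′ ∈ C²_c((0,∞))` and `σ₀ > 1`, the twisted pseudo-Eisenstein series `θ_{f,φ} = E((f∘H)·φ)` (★ D0-χ: bounded, Borel,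
`G(L⁺)`-invariant) pair on `X = G(𝔸)∕G(L⁺)` by the rank-one unfolding: ★ D0 `⟨θ_{f,φ}, θ′⟩ = c_μ∫β•((f∘H)φ·conj θ′)dν_G` (θ′ bounded, `∫⁻β‖(f∘H)φ‖ < ∞` via ★ (δ)₂`[0,∞]` + ★ C) → ★ hAVG (replace
`θ′` by its constant term) → ★ D0-χ `θ′_B = (f′∘H)φ′ + (ν𝓕)⁻¹•(2π)⁻¹∫ f̃′(z)·I_{φ′}(z,·) dy`, `I_{φ′}(z,g) = ∫_{N(𝔸)} (φ′H^z)(w₀ v g) dν` → ★ (δ)₂ (Bochner edition) pushes `∫β•Ψ dν_G`,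
`Ψ = (f∘H)φ·conj θ′_B` (left-`N(𝔸)B(L⁺)`-invariant: ★ `borelConstantTerm_unipotent_mul_of_isMulRightInvariant`, ★ `borelConstantTerm_rational_borel_mul_of_rational_invariant`), to
`K·∫_{𝓕_I} ‖x‖⁻¹•Φ(x) dν_I` where `Φ(d₀ t) = ∫_{K_U} Ψ(t k) dμ_K` is computed POINTWISE by ★ W-a (`H(tk) = ‖d₀‖`, `φ(tk) = χ(d₀)φ(k)`, `φ′(tk) = χ′(d₀)φ′(k)`, `I_{φ′}(z,tk) = ‖d₀‖χ′ʷ(d₀)(‖d₀‖⁻¹)^z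
I_{φ′}(z,k)`), with the radial majorant `Φm(x) = ‖f(‖x‖)‖·C_φ·sup|θ′_B|` (`|θ′_B| ≤ sup|θ′|`, §1) whose `‖x‖⁻¹`-integral over `𝓕_I` is finite by ★ C + ★ Final §1.  The character factors
`χ(x)·conj χ′(x)` (the `w = 1` term) and `χ(x)·conj χ′ʷ(x)` (the `w = w₀` term) of ROADCARD (154) §1 (OD)∕(SD)∕(XF) are now explicit under `∫_{𝓕_I}`; the remaining evaluation (Tate's
Lemma B on `𝓕_I`: norm-twist ⇒ ★ C ∘ ★ A Parseval, otherwise `0`) is part H-χ∕GR-χ.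
* §1 `norm_borelConstantTerm_le` (generic: `|φ_B| ≤ max(sup|φ|, 0)`).
* §2 **`chiPseudoEisenstein_inner_product_eq_setIntegral_ideleClass_cm_two`** (the head; `C = c_μ·K > 0` independent of `χ, χ′, φ, φ′, f, f′, σ₀`).
HONEST LABEL: HC_CM is proved only modulo the 7 printed citations (2 remaining named inputs: hLiu418 = `stmt-HodgeConjecture-24832`, h413 = `stmt-HodgeConjecture-24833`) until rung 0
closes; this file asserts no named fact, closes no socket; count-neutral; letter-free.

## References
* [MoeglinWaldspurger1995] C. Mœglin, J.-L. Waldspurger, *Spectral decomposition and Eisenstein series* (1995), I.2.6, II.1.7, II.2.1.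
* [Rogawski1990] J. D. Rogawski, *Automorphic Representations of Unitary Groups in Three Variables* (1990), §2.1, §7.3 pp. 96–98.
* [GelbartRogawski1991] S. Gelbart, J. Rogawski, *L-functions and Fourier–Jacobi coefficients for the unitary group U(3)*, Invent. Math. 105 (1991), §3.1.
-/

set_option autoImplicit false
set_option linter.dupNamespace false  -- the mandated namespace repeats the summit's segment (`HodgeConjecture.HodgeConjecture`)

noncomputable section

open MeasureTheory Measure Set Filter Topology Complex NumberField IsDedekindDomain MulAction
open scoped Real NNReal ENNReal ComplexConjugate Pointwise
open Literature.MeasureTheory.Group Literature.NumberTheory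
open Literature.NumberTheory.Automorphic Literature.NumberTheory.Automorphic.UnitaryGroup AdelicGroupData
open Literature.NumberTheory.GaloisRepresentations (HeckeCharacter ideleGroup)
open Summit.HodgeConjecture.HodgeConjecture.Cruxes.H413.K2E1BorelEisensteinU
open Summit.HodgeConjecture.HodgeConjecture.Cruxes.H413.K2E1CharacterEisensteinU2Defs
open Summit.HodgeConjecture.HodgeConjecture.Cruxes.H413.K2E1MellinPaleyWienerHalfLine (differentiable_mellin)
open Summit.HodgeConjecture.HodgeConjecture.Cruxes.H413.K2E1BorelCosetsDictionary (forall_arithmeticBorel_iff)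
open Summit.HodgeConjecture.HodgeConjecture.Cruxes.H413.K2E1IdeleClassRadialIntegralCM (setLIntegral_inv_ideleNorm_mul_comp_eq)
open Summit.HodgeConjecture.HodgeConjecture.Cruxes.H413.K2E1PseudoEisensteinRadialCMTwo (exists_integral_quotFun_eisensteinSeriesU_mul_conj_eq lintegral_weight_mul_conj_lt_top)
open Summit.HodgeConjecture.HodgeConjecture.Cruxes.H413.K2E1ChiPseudoEisensteinRadialCMTwo
open Summit.HodgeConjecture.HodgeConjecture.Cruxes.H413.K2E1ChiSectionTorusAverageU2
open Summit.HodgeConjecture.HodgeConjecture.Cruxes.H413.K2E1PseudoEisensteinInnerProductCMTwoFinal (setLIntegral_inv_mul_inv_mul_enorm_lt_top)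
open Summit.HodgeConjecture.HodgeConjecture.Cruxes.H413.K2E1EisensteinPairingUnfoldedWeightU2 (exists_integral_weight_smul_eq_mul_setIntegral_ideleClass_two)
open Summit.HodgeConjecture.HodgeConjecture.Cruxes.H413.K2E1BorelWeightAverage (integral_wt_smul_mul_conj_eq_mul_conj_borelConstantTerm_two)
open Summit.HodgeConjecture.HodgeConjecture.Cruxes.H413.K2E1TruncatedEisensteinBoundedCMThree (measurable_borelConstantTerm)
open Summit.HodgeConjecture.HodgeConjecture.Cruxes.H413.K2E1UnipotentHaarNormalisationU2 (isInvInvariant_of_isHaarMeasure_two)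
open Summit.HodgeConjecture.HodgeConjecture.Cruxes.H413.K2E1SphericalIntertwiningMellinCMTwo (sigmaFinite_haar_adelicUnipotent_cm_two)

namespace Summit.HodgeConjecture.HodgeConjecture.Cruxes.H413.K2E1ChiPseudoEisensteinIdeleLevelCMTwo

/-! ## §1 Generic: the constant term of a bounded function is bounded by the same constant -/

section Generic

variable {F E : Type} [Field F] [NumberField F] [Field E] [NumberField E] [Algebra F E] {c : E ≃ₐ[F] E} {N : ℕ}
variable [MeasurableSpace (quasiSplit F E c N).Adelic]

/-- **`‖φ_B(g)‖ ≤ max(M, 0)`** if `‖φ‖ ≤ M` everywhere (`φ_B = (ν𝓕)⁻¹•∫_𝓕 φ(u g) dν`, `ν𝓕 < ∞`; the degenerate `ν𝓕 = 0` gives `0`). [cite: MoeglinWaldspurger1995, I.2.6] -/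
theorem norm_borelConstantTerm_le (ν : Measure ↥(adelicUnipotent F E c N)) {𝓕 : Set ↥(adelicUnipotent F E c N)} (h𝓕top : ν 𝓕 ≠ ∞)
    {φ : (quasiSplit F E c N).Adelic → ℂ} {M : ℝ} (hM : ∀ g, ‖φ g‖ ≤ M) (g : (quasiSplit F E c N).Adelic) :
    ‖borelConstantTerm ν 𝓕 φ g‖ ≤ max M 0 := by
  rw [borelConstantTerm_def, norm_smul, Real.norm_eq_abs, abs_inv, abs_of_nonneg ENNReal.toReal_nonneg]
  have h1 : ‖∫ u in 𝓕, φ ((u : (quasiSplit F E c N).Adelic) * g) ∂ν‖ ≤ max M 0 * ν.real 𝓕 :=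
    norm_setIntegral_le_of_norm_le_const h𝓕top.lt_top fun u _ => (hM _).trans (le_max_left _ _)
  by_cases h0 : (ν 𝓕).toReal = 0
  · rw [h0, inv_zero, zero_mul]; exact le_max_right _ _
  · calc (ν 𝓕).toReal⁻¹ * ‖∫ u in 𝓕, φ ((u : (quasiSplit F E c N).Adelic) * g) ∂ν‖ ≤ (ν 𝓕).toReal⁻¹ * (max M 0 * ν.real 𝓕) :=
          mul_le_mul_of_nonneg_left h1 (inv_nonneg.2 ENNReal.toReal_nonneg)
      _ = max M 0 := by rw [measureReal_def, mul_comm (max M 0), ← mul_assoc, inv_mul_cancel₀ h0, one_mul]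

end Generic

/-! ## §2 The HEAD: the twisted pseudo-Eisenstein inner product as an idele class integral -/

section Head

variable (L : Type) [Field L] [NumberField L] [IsCMField L]
variable [MeasurableSpace (quasiSplit (↥(maximalRealSubfield L)) L (IsCMField.complexConj L) 2).Adelic] [BorelSpace (quasiSplit (↥(maximalRealSubfield L)) L (IsCMField.complexConj L) 2).Adelic]
variable [MeasurableSpace (AdeleRing (𝓞 L) L)ˣ] [BorelSpace (AdeleRing (𝓞 L) L)ˣ]

/-- **THE TWISTED PSEUDO-EISENSTEIN INNER PRODUCT AS AN IDELE CLASS INTEGRAL (`U(1,1)_{L∕L⁺}`, MW II.2.1 before the last evaluation).**  Data as in ★ Final: an automorphic `μ` on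
`X = G(𝔸)∕G(L⁺)`, Haar `ν_G` (inversion-invariant), `μ_K` on `K_U`, `ν_I` on `𝕀_L` with an idele class domain `𝓕_I`, `ν` on `N(𝔸)` with a fundamental domain `𝓕` of `N(L⁺)` of compact
closure and `ν𝓕 ≠ 0`.  THEN there is ONE `C > 0` (`= c_μ·K`, independent of all the data below) such that for all Hecke characters `χ, χ′` of `L`, all continuous bounded `χ`-∕`χ′`-sections `φ, φ′`,
all `f, f′ ∈ C²_c((0,∞))` and every `σ₀ > 1` (`z = σ₀ + iy`, `f̃′(z) = mellin f′ (−z)`, `I(z,k) = ∫_{N(𝔸)} (φ′H^z)(w₀ v k) dν`, `χ′ʷ = reflectChar c χ′`): the pairing of `θ_{f,φ} = E((f∘H)φ)`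
and `θ_{f′,φ′}` over `X` is `μ`-integrable and
**`∫_X θ_{f,φ}·conj θ_{f′,φ′} dμ = C·∫_{𝓕_I} ‖x‖⁻¹ • ( ∫_{K_U} f(‖x‖)·(χ(x)φ(k))·conj( f′(‖x‖)·(χ′(x)φ′(k)) + (ν𝓕)⁻¹ • ((2π)⁻¹·∫_ℝ f̃′(z)·(‖x‖·(χ′ʷ(x)·(‖x‖⁻¹)^z)·I(z,k)) dy) ) dμ_K ) dν_I`**.
[cite: MoeglinWaldspurger1995, II.2.1] [cite: Rogawski1990, §7.3 (pp. 96–98)] [cite: GelbartRogawski1991, §3.1] -/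
theorem chiPseudoEisenstein_inner_product_eq_setIntegral_ideleClass_cm_two
    (μ : Measure (quasiSplit (↥(maximalRealSubfield L)) L (IsCMField.complexConj L) 2).automorphicQuotient) [(quasiSplit (↥(maximalRealSubfield L)) L (IsCMField.complexConj L) 2).IsAutomorphicMeasure μ]
    (νG : Measure (quasiSplit (↥(maximalRealSubfield L)) L (IsCMField.complexConj L) 2).Adelic) [νG.IsHaarMeasure] [νG.IsInvInvariant]
    (μK : Measure ((standardMaximalCompactGL 2 L).comap (adelicVal (↥(maximalRealSubfield L)) L (IsCMField.complexConj L) 2 ((StdForm.antidiagonal 2).over L)) : Subgroup (quasiSplit (↥(maximalRealSubfield L)) L (IsCMField.complexConj L) 2).Adelic))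
    [μK.IsHaarMeasure]
    (νI : Measure (AdeleRing (𝓞 L) L)ˣ) [νI.IsHaarMeasure]
    {𝓕I : Set (AdeleRing (𝓞 L) L)ˣ} (h𝓕I : IsIdeleClassDomain L 𝓕I)
    (ν : Measure ↥(adelicUnipotent (↥(maximalRealSubfield L)) L (IsCMField.complexConj L) 2)) [ν.IsHaarMeasure]
    {𝓕 : Set ↥(adelicUnipotent (↥(maximalRealSubfield L)) L (IsCMField.complexConj L) 2)}
    (h𝓕N : IsFundamentalDomain ↥(rationalUnipotent (↥(maximalRealSubfield L)) L (IsCMField.complexConj L) 2) 𝓕 ν) (h𝓕c : IsCompact (closure 𝓕)) (h𝓕₀ : ν 𝓕 ≠ 0) :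
    ∃ C : ℝ, 0 < C ∧
      ∀ {χ χ' : HeckeCharacter L} {φ φ' : (quasiSplit (↥(maximalRealSubfield L)) L (IsCMField.complexConj L) 2).Adelic → ℂ},
        IsChiSection χ φ → Continuous φ → ∀ {Cφ : ℝ}, (∀ x, ‖φ x‖ ≤ Cφ) →
        IsChiSection χ' φ' → Continuous φ' → ∀ {Cφ' : ℝ}, (∀ x, ‖φ' x‖ ≤ Cφ') →
      ∀ {f f' : ℝ → ℂ}, ContDiff ℝ 2 f → HasCompactSupport f → tsupport f ⊆ Ioi 0 → ContDiff ℝ 2 f' → HasCompactSupport f' → tsupport f' ⊆ Ioi 0 →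
      ∀ {σ₀ : ℝ}, 1 < σ₀ →
        Integrable (fun x : (quasiSplit (↥(maximalRealSubfield L)) L (IsCMField.complexConj L) 2).automorphicQuotient =>
            (quasiSplit (↥(maximalRealSubfield L)) L (IsCMField.complexConj L) 2).quotFun (eisensteinSeriesU (fun g : (quasiSplit (↥(maximalRealSubfield L)) L (IsCMField.complexConj L) 2).Adelic => f (borelHeight g : ℝ) * φ g)) x *
              conj ((quasiSplit (↥(maximalRealSubfield L)) L (IsCMField.complexConj L) 2).quotFun (eisensteinSeriesU (fun g : (quasiSplit (↥(maximalRealSubfield L)) L (IsCMField.complexConj L) 2).Adelic => f' (borelHeight g : ℝ) * φ' g)) x)) μ ∧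
        ∫ x, (quasiSplit (↥(maximalRealSubfield L)) L (IsCMField.complexConj L) 2).quotFun (eisensteinSeriesU (fun g : (quasiSplit (↥(maximalRealSubfield L)) L (IsCMField.complexConj L) 2).Adelic => f (borelHeight g : ℝ) * φ g)) x *
            conj ((quasiSplit (↥(maximalRealSubfield L)) L (IsCMField.complexConj L) 2).quotFun (eisensteinSeriesU (fun g : (quasiSplit (↥(maximalRealSubfield L)) L (IsCMField.complexConj L) 2).Adelic => f' (borelHeight g : ℝ) * φ' g)) x) ∂μ =
          (C : ℂ) * ∫ x in 𝓕I, (IdeleClassGroup.ideleNorm L x : ℝ)⁻¹ •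
            (∫ k : ((standardMaximalCompactGL 2 L).comap (adelicVal (↥(maximalRealSubfield L)) L (IsCMField.complexConj L) 2 ((StdForm.antidiagonal 2).over L)) : Subgroup (quasiSplit (↥(maximalRealSubfield L)) L (IsCMField.complexConj L) 2).Adelic),
              f (IdeleClassGroup.ideleNorm L x : ℝ) * (((χ x : ℂˣ) : ℂ) * φ (k : (quasiSplit (↥(maximalRealSubfield L)) L (IsCMField.complexConj L) 2).Adelic)) *
                conj (f' (IdeleClassGroup.ideleNorm L x : ℝ) * (((χ' x : ℂˣ) : ℂ) * φ' (k : (quasiSplit (↥(maximalRealSubfield L)) L (IsCMField.complexConj L) 2).Adelic)) +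
                  ((ν 𝓕).toReal⁻¹ : ℝ) • ((((2 * π)⁻¹ : ℝ) : ℂ) * ∫ y : ℝ, mellin f' (-((σ₀ : ℂ) + y * I)) *
                    ((((IdeleClassGroup.ideleNorm L x : ℝ≥0) : ℝ) : ℂ) * ((((reflectChar (IsCMField.complexConj L) χ') x : ℂˣ) : ℂ) * ((((IdeleClassGroup.ideleNorm L x)⁻¹ : ℝ≥0) : ℝ) : ℂ) ^ ((σ₀ : ℂ) + y * I)) *
                      ∫ v : ↥(adelicUnipotent (↥(maximalRealSubfield L)) L (IsCMField.complexConj L) 2), flatSectionU φ' ((σ₀ : ℂ) + y * I)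
                        ((quasiSplit (↥(maximalRealSubfield L)) L (IsCMField.complexConj L) 2).toAdelic (weylLongU ((IsCMField.complexConj L : L ≃ₐ[↥(maximalRealSubfield L)] L) : L →+* L) (rfl : (StdForm.antidiagonal 2).over L = (StdForm.antidiagonal 2).over L)) *
                          ((v : (quasiSplit (↥(maximalRealSubfield L)) L (IsCMField.complexConj L) 2).Adelic) * (k : (quasiSplit (↥(maximalRealSubfield L)) L (IsCMField.complexConj L) 2).Adelic))) ∂ν))) ∂μK) ∂νI := by
  classical
  -- (0) structure on `G(𝔸)`, constants
  haveI := t2Space_adeleRing_of_numberField L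
  haveI := locallyCompactSpace_adeleRing' L
  haveI := secondCountableTopology_adeleRing L
  haveI : SecondCountableTopology (quasiSplit (↥(maximalRealSubfield L)) L (IsCMField.complexConj L) 2).Adelic :=
    inferInstanceAs (SecondCountableTopology (adelic (↥(maximalRealSubfield L)) L (IsCMField.complexConj L) 2 ((StdForm.antidiagonal 2).over L)))
  haveI : ν.IsInvInvariant := isInvInvariant_of_isHaarMeasure_two ν
  haveI : ν.IsMulRightInvariant := isMulRightInvariant_of_isMulLeftInvariant_two ν
  haveI := sigmaFinite_haar_adelicUnipotent_cm_two L ν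
  have h𝓕top : ν 𝓕 ≠ ∞ := ((measure_mono subset_closure).trans_lt h𝓕c.measure_lt_top).ne
  have hc : IsCMField.complexConj L * IsCMField.complexConj L = 1 := AlgEquiv.ext fun x => IsCMField.complexConj_apply_apply L x
  have hc1 : IsCMField.complexConj L ≠ 1 := IsCMField.complexConj_ne_one L
  have hBK := exists_mem_borelAdelic_mul_mem_standardMaximalCompactGL_cm L (N := 2)
  have hKc : IsCompact (((standardMaximalCompactGL 2 L).comap (adelicVal (↥(maximalRealSubfield L)) L (IsCMField.complexConj L) 2 ((StdForm.antidiagonal 2).over L)) :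
      Subgroup (quasiSplit (↥(maximalRealSubfield L)) L (IsCMField.complexConj L) 2).Adelic) : Set (quasiSplit (↥(maximalRealSubfield L)) L (IsCMField.complexConj L) 2).Adelic) :=
    isCompact_comap_adelicVal_standardMaximalCompactGL
  haveI : CompactSpace ((standardMaximalCompactGL 2 L).comap (adelicVal (↥(maximalRealSubfield L)) L (IsCMField.complexConj L) 2 ((StdForm.antidiagonal 2).over L)) :
      Subgroup (quasiSplit (↥(maximalRealSubfield L)) L (IsCMField.complexConj L) 2).Adelic) := isCompact_iff_compactSpace.1 hKc
  haveI : IsFiniteMeasure μK := CompactSpace.isFiniteMeasure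
  haveI : DiscreteTopology (quasiSplit (↥(maximalRealSubfield L)) L (IsCMField.complexConj L) 2).arithmeticSubgroup := isDiscreteRational_quasiSplit
  haveI : DiscreteTopology ↥((arithmeticBorel (↥(maximalRealSubfield L)) L (IsCMField.complexConj L) 2).map (quasiSplit (↥(maximalRealSubfield L)) L (IsCMField.complexConj L) 2).arithmeticSubgroup.subtype) :=
    DiscreteTopology.of_subset ‹DiscreteTopology (quasiSplit (↥(maximalRealSubfield L)) L (IsCMField.complexConj L) 2).arithmeticSubgroup› (Subgroup.map_subtype_le _)
  obtain ⟨β, hβ⟩ := exists_isCoveringWeight ((arithmeticBorel (↥(maximalRealSubfield L)) L (IsCMField.complexConj L) 2).map (quasiSplit (↥(maximalRealSubfield L)) L (IsCMField.complexConj L) 2).arithmeticSubgroup.subtype)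
  obtain ⟨cμ, hcμ, hunf⟩ := exists_integral_quotFun_eisensteinSeriesU_mul_conj_eq (F := ↥(maximalRealSubfield L)) (E := L) (c := IsCMField.complexConj L) (N := 2) μ νG
  obtain ⟨K, hK0, hKt, hδ0, hδ⟩ := exists_integral_weight_smul_eq_mul_setIntegral_ideleClass_two hc hc1 νG μK νI hBK h𝓕I
  have hVt : idelicCovolume L νI ≠ ∞ := idelicCovolume_ne_top νI
  refine ⟨cμ * K.toReal, mul_pos hcμ (ENNReal.toReal_pos hK0 hKt), ?_⟩
  intro χ χ' φ φ' hφ hφc Cφ hφC hφ' hφ'c Cφ' hφ'C f f' hf hfs hf0 hf' hf's hf'0 σ₀ hσ₀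
  have hIm : Measurable fun x : (AdeleRing (𝓞 L) L)ˣ => IdeleClassGroup.ideleNorm L x := (continuous_ideleNorm_holds L).measurable
  have hIc : Continuous fun x : (AdeleRing (𝓞 L) L)ˣ => (IdeleClassGroup.ideleNorm L x : ℝ) := NNReal.continuous_coe.comp (continuous_ideleNorm_holds L)
  have hHc : Continuous fun g : (quasiSplit (↥(maximalRealSubfield L)) L (IsCMField.complexConj L) 2).Adelic => (borelHeight g : ℝ) := NNReal.continuous_coe.comp continuous_borelHeight
  -- names: `W`, `κ`, `θ′ = θ_{f′,φ′}`, `Ψ = (f∘H)φ·conj θ′_B`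
  set κN : ℝ := (ν 𝓕).toReal⁻¹ with hκN
  set θ' : (quasiSplit (↥(maximalRealSubfield L)) L (IsCMField.complexConj L) 2).Adelic → ℂ :=
    eisensteinSeriesU (fun g : (quasiSplit (↥(maximalRealSubfield L)) L (IsCMField.complexConj L) 2).Adelic => f' (borelHeight g : ℝ) * φ' g) with hθ'
  set Ψ : (quasiSplit (↥(maximalRealSubfield L)) L (IsCMField.complexConj L) 2).Adelic → ℂ := fun g => f (borelHeight g : ℝ) * φ g * conj (borelConstantTerm ν 𝓕 θ' g) with hΨ
  -- (1) `θ′` is Borel, `G(L⁺)`-invariant, bounded; its constant term is bounded and left-`N(𝔸)B(L⁺)`-invariant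
  obtain ⟨M₁, hM₁⟩ := exists_bound_eisensteinSeriesU_comp_borelHeight_mul_cm_two L hf'.continuous hf's hf'0 hφ'c hφ'C hφ'.toAdelic_mul
  have hθ'm : Measurable θ' := measurable_eisensteinSeriesU_comp_borelHeight_mul_cm_two L hf'.continuous hf's hf'0 hφ'c hφ'C
  have hθ'G : ∀ (γ : (quasiSplit (↥(maximalRealSubfield L)) L (IsCMField.complexConj L) 2).arithmeticSubgroup) (x : (quasiSplit (↥(maximalRealSubfield L)) L (IsCMField.complexConj L) 2).Adelic),
      θ' ((γ : (quasiSplit (↥(maximalRealSubfield L)) L (IsCMField.complexConj L) 2).Adelic) * x) = θ' x := eisensteinSeriesU_comp_borelHeight_mul_arithmeticSubgroup_mul f' hφ'.toAdelic_mul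
  have hCTb : ∀ g, ‖borelConstantTerm ν 𝓕 θ' g‖ ≤ max M₁ 0 := norm_borelConstantTerm_le ν h𝓕top hM₁
  have hCTm : Measurable (borelConstantTerm ν 𝓕 θ') := measurable_borelConstantTerm ν 𝓕 hθ'm
  have hCTN : ∀ u : (quasiSplit (↥(maximalRealSubfield L)) L (IsCMField.complexConj L) 2).Adelic, u ∈ adelicUnipotent (↥(maximalRealSubfield L)) L (IsCMField.complexConj L) 2 →
      ∀ y, borelConstantTerm ν 𝓕 θ' (u * y) = borelConstantTerm ν 𝓕 θ' y := fun u hu y =>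
    borelConstantTerm_unipotent_mul_of_isMulRightInvariant ν h𝓕N
      (fun u' hu' x => hθ'G ⟨(u' : (quasiSplit (↥(maximalRealSubfield L)) L (IsCMField.complexConj L) 2).Adelic), hu'⟩ x) ⟨u, hu⟩ y
  have hCTB : ∀ b ∈ arithmeticBorel (↥(maximalRealSubfield L)) L (IsCMField.complexConj L) 2, ∀ y : (quasiSplit (↥(maximalRealSubfield L)) L (IsCMField.complexConj L) 2).Adelic,
      borelConstantTerm ν 𝓕 θ' ((b : (quasiSplit (↥(maximalRealSubfield L)) L (IsCMField.complexConj L) 2).Adelic) * y) = borelConstantTerm ν 𝓕 θ' y := fun b hb y =>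
    borelConstantTerm_rational_borel_mul_of_rational_invariant ν h𝓕N hθ'G b hb y
  have hφN : ∀ u : (quasiSplit (↥(maximalRealSubfield L)) L (IsCMField.complexConj L) 2).Adelic, u ∈ adelicUnipotent (↥(maximalRealSubfield L)) L (IsCMField.complexConj L) 2 →
      ∀ y, φ (u * y) = φ y := fun u hu y => hφ.unipotent_mul ⟨u, hu⟩ y
  have hφB := (forall_arithmeticBorel_iff (ψ := φ)).2 hφ.toAdelic_mul
  -- (2) the `L¹` letter `∫⁻ β‖(f∘H)φ‖ < ∞` (radial majorant `C_φ‖f∘H‖`, ★ (δ)₂ `[0,∞]` + ★ C + ★ Final §1)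
  have hfm : Measurable fun g : (quasiSplit (↥(maximalRealSubfield L)) L (IsCMField.complexConj L) 2).Adelic => f (borelHeight g : ℝ) := (hf.continuous.comp hHc).measurable
  have hψm : Measurable fun g : (quasiSplit (↥(maximalRealSubfield L)) L (IsCMField.complexConj L) 2).Adelic => f (borelHeight g : ℝ) * φ g := hfm.mul hφc.measurable
  have hHtk := borelHeight_torus_mul_maximalCompact (F := ↥(maximalRealSubfield L)) (E := L) (c := IsCMField.complexConj L)
  have hL1r : ∫⁻ g, β g * ‖f (borelHeight g : ℝ)‖ₑ ∂νG < ∞ := by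
    have hL := hδ0 β hβ (fun g => ‖f (borelHeight g : ℝ)‖ₑ) hfm.enorm
      (fun n y => by simp only [borelHeight_unipotent_mul ((mem_unipotentInBorel_iff _).1 n.2)])
      (fun b hb y => by simp only [K2E1TruncatedEisensteinExplicit.borelHeight_arithmeticBorel_mul hb])
      (fun x => ‖f (IdeleClassGroup.ideleNorm L x : ℝ)‖ₑ * μK Set.univ) ((hf.continuous.comp hIc).measurable.enorm.mul_const _)
      (fun k hk x => by simp only [map_mul, ideleNorm_principal hk, one_mul]) (fun t => by simp_rw [hHtk t]; exact lintegral_const _)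
    rw [hL, setLIntegral_inv_ideleNorm_mul_comp_eq νI h𝓕I (Gm := fun r => ‖f r‖ₑ * μK Set.univ) (hf.continuous.measurable.enorm.mul_const _)]
    exact ENNReal.mul_lt_top hKt.lt_top (ENNReal.mul_lt_top hVt.lt_top (setLIntegral_inv_mul_inv_mul_enorm_lt_top hf.continuous hfs hf0 (measure_ne_top μK _)))
  have hL1 : ∫⁻ g, β g * ‖f (borelHeight g : ℝ) * φ g‖ₑ ∂νG < ∞ := by
    have hφe : ∀ g, ‖φ g‖ₑ ≤ ENNReal.ofReal Cφ := fun g => by rw [← ofReal_norm]; exact ENNReal.ofReal_le_ofReal (hφC g)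
    calc ∫⁻ g, β g * ‖f (borelHeight g : ℝ) * φ g‖ₑ ∂νG ≤ ∫⁻ g, β g * ‖f (borelHeight g : ℝ)‖ₑ * ENNReal.ofReal Cφ ∂νG :=
          lintegral_mono fun g => by rw [enorm_mul, ← mul_assoc]; gcongr; exact hφe g
      _ = (∫⁻ g, β g * ‖f (borelHeight g : ℝ)‖ₑ ∂νG) * ENNReal.ofReal Cφ := lintegral_mul_const' _ _ ENNReal.ofReal_ne_top
      _ < ∞ := ENNReal.mul_lt_top hL1r ENNReal.ofReal_lt_top
  -- (3) unfolding `X → B(F)`-weight level, then the average is free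
  obtain ⟨hInt, hEq⟩ := hunf hβ (f := fun g => f (borelHeight g : ℝ) * φ g) (Λ' := θ') hψm (comp_borelHeight_mul_arithmeticBorel_mul f hφ.toAdelic_mul) hθ'm hθ'G hM₁ hL1
  refine ⟨hInt, ?_⟩
  have hAVG := integral_wt_smul_mul_conj_eq_mul_conj_borelConstantTerm_two hc hc1 νG ν h𝓕N h𝓕₀ h𝓕top hβ (ψ := fun g => f (borelHeight g : ℝ) * φ g) (Λ' := θ') hψm hθ'm
    (comp_borelHeight_mul_unipotent_mul f hφ.unipotent_mul) (comp_borelHeight_mul_arithmeticBorel_mul f hφ.toAdelic_mul) (fun b _ x => hθ'G b x) (lintegral_weight_mul_conj_lt_top νG β hM₁ hL1)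
  have hΨeq : ∫ g, (β g).toReal • ((fun g : (quasiSplit (↥(maximalRealSubfield L)) L (IsCMField.complexConj L) 2).Adelic => f (borelHeight g : ℝ) * φ g) g * conj (borelConstantTerm ν 𝓕 θ' g)) ∂νG =
      ∫ g, (β g).toReal • Ψ g ∂νG := rfl
  -- (4) the constant term of `θ′` in Mellin form (★ D0-χ)
  have hCT : ∀ g : (quasiSplit (↥(maximalRealSubfield L)) L (IsCMField.complexConj L) 2).Adelic, borelConstantTerm ν 𝓕 θ' g =
      f' (borelHeight g : ℝ) * φ' g + κN • ((((2 * π)⁻¹ : ℝ) : ℂ) * ∫ y : ℝ, mellin f' (-((σ₀ : ℂ) + y * I)) *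
        ∫ v : ↥(adelicUnipotent (↥(maximalRealSubfield L)) L (IsCMField.complexConj L) 2), flatSectionU φ' ((σ₀ : ℂ) + y * I) (((quasiSplit (↥(maximalRealSubfield L)) L (IsCMField.complexConj L) 2).toAdelic (weylLongU ((IsCMField.complexConj L : L ≃ₐ[↥(maximalRealSubfield L)] L) : L →+* L) (rfl : (StdForm.antidiagonal 2).over L = (StdForm.antidiagonal 2).over L))) * ((v : (quasiSplit (↥(maximalRealSubfield L)) L (IsCMField.complexConj L) 2).Adelic) * g)) ∂ν) := fun g => by
    rw [hθ', borelConstantTerm_eisensteinSeriesU_comp_borelHeight_mul_cm_two L ν h𝓕N h𝓕c hf'.continuous hf's hf'0 hφ'c hφ'C hφ'.unipotent_mul hφ'.toAdelic_mul g]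
    simp_rw [mul_assoc]
    rw [integral_comp_borelHeight_mul_weylLongU_eq_mellin_cm_two L ν h𝓕N h𝓕c hf' hf's hf'0 hφ'c hφ'C hσ₀ g]
  -- (5) measurability of `Ψ` and of the idele-side `Φ` (parametric integrals of jointly measurable integrands)
  have hΨm : Measurable Ψ := hψm.mul (continuous_conj.measurable.comp hCTm)
  have hχc : ∀ ξ : HeckeCharacter L, Continuous fun x : (AdeleRing (𝓞 L) L)ˣ => ((ξ x : ℂˣ) : ℂ) := fun ξ => Units.continuous_val.comp (map_continuous ξ)
  have hIic : Continuous fun x : (AdeleRing (𝓞 L) L)ˣ => ((((IdeleClassGroup.ideleNorm L x)⁻¹ : ℝ≥0) : ℝ) : ℂ) :=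
    continuous_ofReal.comp (NNReal.continuous_coe.comp ((continuous_ideleNorm_holds L).inv₀ fun x => ne_of_gt (by exact_mod_cast ideleNorm_real_pos x)))
  -- `I(z, k)` as a jointly measurable function of `(k, y)`, then the `y`-integrand `S`, then `Φ`
  set Iφ' : ((standardMaximalCompactGL 2 L).comap (adelicVal (↥(maximalRealSubfield L)) L (IsCMField.complexConj L) 2 ((StdForm.antidiagonal 2).over L)) : Subgroup (quasiSplit (↥(maximalRealSubfield L)) L (IsCMField.complexConj L) 2).Adelic) × ℝ → ℂ := fun p => ∫ v : ↥(adelicUnipotent (↥(maximalRealSubfield L)) L (IsCMField.complexConj L) 2), flatSectionU φ' ((σ₀ : ℂ) + p.2 * I) (((quasiSplit (↥(maximalRealSubfield L)) L (IsCMField.complexConj L) 2).toAdelic (weylLongU ((IsCMField.complexConj L : L ≃ₐ[↥(maximalRealSubfield L)] L) : L →+* L) (rfl : (StdForm.antidiagonal 2).over L = (StdForm.antidiagonal 2).over L))) * ((v : (quasiSplit (↥(maximalRealSubfield L)) L (IsCMField.complexConj L) 2).Adelic) * (p.1 : (quasiSplit (↥(maximalRealSubfield L)) L (IsCMField.complexConj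 L) 2).Adelic))) ∂ν with hIφ'
  have hmW : Continuous fun q : (((standardMaximalCompactGL 2 L).comap (adelicVal (↥(maximalRealSubfield L)) L (IsCMField.complexConj L) 2 ((StdForm.antidiagonal 2).over L)) : Subgroup (quasiSplit (↥(maximalRealSubfield L)) L (IsCMField.complexConj L) 2).Adelic) × ℝ) × ↥(adelicUnipotent (↥(maximalRealSubfield L)) L (IsCMField.complexConj L) 2) => ((quasiSplit (↥(maximalRealSubfield L)) L (IsCMField.complexConj L) 2).toAdelic (weylLongU ((IsCMField.complexConj L : L ≃ₐ[↥(maximalRealSubfield L)] L) : L →+* L) (rfl : (StdForm.antidiagonal 2).over L = (StdForm.antidiagonal 2).over L))) * ((q.2 : (quasiSplit (↥(maximalRealSubfield L)) L (IsCMField.complexConj L) 2).Adelic) * (q.1.1 : (quasiSplit (↥(maximalRealSubfield L)) L (IsCMField.complexConj L) 2).Adelic)) :=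
    continuous_const.mul ((continuous_subtype_val.comp continuous_snd).mul (continuous_subtype_val.comp (continuous_fst.comp continuous_fst)))
  have hR : Measurable fun q : (((standardMaximalCompactGL 2 L).comap (adelicVal (↥(maximalRealSubfield L)) L (IsCMField.complexConj L) 2 ((StdForm.antidiagonal 2).over L)) : Subgroup (quasiSplit (↥(maximalRealSubfield L)) L (IsCMField.complexConj L) 2).Adelic) × ℝ) × ↥(adelicUnipotent (↥(maximalRealSubfield L)) L (IsCMField.complexConj L) 2) => flatSectionU φ' ((σ₀ : ℂ) + q.1.2 * I) (((quasiSplit (↥(maximalRealSubfield L)) L (IsCMField.complexConj L) 2).toAdelic (weylLongU ((IsCMField.complexConj L : L ≃ₐ[↥(maximalRealSubfield L)] L) : L →+* L) (rfl : (StdForm.antidiagonal 2).over L = (StdForm.antidiagonal 2).over L))) * ((q.2 : (quasiSplit (↥(maximalRealSubfield L)) L (IsCMField.complexConj L) 2).Adelic) * (q.1.1 : (quasiSplit (↥(maximalRealSubfield L)) L (IsCMField.complexConj L) 2).Adelic))) := by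
    simp only [flatSectionU_apply]
    exact (hφ'c.measurable.comp hmW.measurable).mul (((continuous_ofReal.comp hHc).measurable.comp hmW.measurable).pow (by fun_prop))
  have hIφ'm : Measurable Iφ' := (hR.stronglyMeasurable.integral_prod_right' (ν := ν)).measurable
  set S : ((AdeleRing (𝓞 L) L)ˣ × ((standardMaximalCompactGL 2 L).comap (adelicVal (↥(maximalRealSubfield L)) L (IsCMField.complexConj L) 2 ((StdForm.antidiagonal 2).over L)) : Subgroup (quasiSplit (↥(maximalRealSubfield L)) L (IsCMField.complexConj L) 2).Adelic)) × ℝ → ℂ := fun q => mellin f' (-((σ₀ : ℂ) + q.2 * I)) *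
    ((((IdeleClassGroup.ideleNorm L q.1.1 : ℝ≥0) : ℝ) : ℂ) * ((((reflectChar (IsCMField.complexConj L) χ') q.1.1 : ℂˣ) : ℂ) * ((((IdeleClassGroup.ideleNorm L q.1.1)⁻¹ : ℝ≥0) : ℝ) : ℂ) ^ ((σ₀ : ℂ) + q.2 * I)) * Iφ' (q.1.2, q.2)) with hS
  have hmel : Continuous fun y : ℝ => mellin f' (-((σ₀ : ℂ) + y * I)) :=
    (differentiable_mellin hf'.continuous hf's hf'0).continuous.comp (by fun_prop : Continuous fun y : ℝ => -((σ₀ : ℂ) + y * I))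
  have hS1 : Measurable fun q : ((AdeleRing (𝓞 L) L)ˣ × ((standardMaximalCompactGL 2 L).comap (adelicVal (↥(maximalRealSubfield L)) L (IsCMField.complexConj L) 2 ((StdForm.antidiagonal 2).over L)) : Subgroup (quasiSplit (↥(maximalRealSubfield L)) L (IsCMField.complexConj L) 2).Adelic)) × ℝ => mellin f' (-((σ₀ : ℂ) + q.2 * I)) := hmel.measurable.comp measurable_snd
  have hS2 : Measurable fun q : ((AdeleRing (𝓞 L) L)ˣ × ((standardMaximalCompactGL 2 L).comap (adelicVal (↥(maximalRealSubfield L)) L (IsCMField.complexConj L) 2 ((StdForm.antidiagonal 2).over L)) : Subgroup (quasiSplit (↥(maximalRealSubfield L)) L (IsCMField.complexConj L) 2).Adelic)) × ℝ =>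
      ((((IdeleClassGroup.ideleNorm L q.1.1 : ℝ≥0) : ℝ) : ℂ) * ((((reflectChar (IsCMField.complexConj L) χ') q.1.1 : ℂˣ) : ℂ) * ((((IdeleClassGroup.ideleNorm L q.1.1)⁻¹ : ℝ≥0) : ℝ) : ℂ) ^ ((σ₀ : ℂ) + q.2 * I))) :=
    ((continuous_ofReal.comp hIc).measurable.comp (measurable_fst.comp measurable_fst)).mul
      (((hχc _).measurable.comp (measurable_fst.comp measurable_fst)).mul ((hIic.measurable.comp (measurable_fst.comp measurable_fst)).pow (by fun_prop)))
  have hS3 : Measurable fun q : ((AdeleRing (𝓞 L) L)ˣ × ((standardMaximalCompactGL 2 L).comap (adelicVal (↥(maximalRealSubfield L)) L (IsCMField.complexConj L) 2 ((StdForm.antidiagonal 2).over L)) : Subgroup (quasiSplit (↥(maximalRealSubfield L)) L (IsCMField.complexConj L) 2).Adelic)) × ℝ => Iφ' (q.1.2, q.2) := hIφ'm.comp ((measurable_snd.comp measurable_fst).prodMk measurable_snd)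
  have hSm : Measurable S := hS1.mul (hS2.mul hS3)
  have hJm : Measurable fun p : (AdeleRing (𝓞 L) L)ˣ × ((standardMaximalCompactGL 2 L).comap (adelicVal (↥(maximalRealSubfield L)) L (IsCMField.complexConj L) 2 ((StdForm.antidiagonal 2).over L)) : Subgroup (quasiSplit (↥(maximalRealSubfield L)) L (IsCMField.complexConj L) 2).Adelic) => ∫ y, S (p, y) := (hSm.stronglyMeasurable.integral_prod_right' (ν := (volume : Measure ℝ))).measurable
  have hBm : Measurable fun p : (AdeleRing (𝓞 L) L)ˣ × ((standardMaximalCompactGL 2 L).comap (adelicVal (↥(maximalRealSubfield L)) L (IsCMField.complexConj L) 2 ((StdForm.antidiagonal 2).over L)) : Subgroup (quasiSplit (↥(maximalRealSubfield L)) L (IsCMField.complexConj L) 2).Adelic) => f (IdeleClassGroup.ideleNorm L p.1 : ℝ) * (((χ p.1 : ℂˣ) : ℂ) * φ (p.2 : (quasiSplit (↥(maximalRealSubfield L)) L (IsCMField.complexConj L) 2).Adelic)) *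
      conj (f' (IdeleClassGroup.ideleNorm L p.1 : ℝ) * (((χ' p.1 : ℂˣ) : ℂ) * φ' (p.2 : (quasiSplit (↥(maximalRealSubfield L)) L (IsCMField.complexConj L) 2).Adelic)) + κN • ((((2 * π)⁻¹ : ℝ) : ℂ) * ∫ y, S (p, y))) :=
    ((((hf.continuous.comp hIc).measurable.comp measurable_fst).mul ((((hχc χ).measurable.comp measurable_fst)).mul (hφc.measurable.comp (measurable_subtype_coe.comp measurable_snd)))).mul
      (continuous_conj.measurable.comp ((((hf'.continuous.comp hIc).measurable.comp measurable_fst).mul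
        ((((hχc χ').measurable.comp measurable_fst)).mul (hφ'c.measurable.comp (measurable_subtype_coe.comp measurable_snd)))).add ((measurable_const.mul hJm).const_smul κN))))
  have hΦm : Measurable fun x : (AdeleRing (𝓞 L) L)ˣ => ∫ k : ((standardMaximalCompactGL 2 L).comap (adelicVal (↥(maximalRealSubfield L)) L (IsCMField.complexConj L) 2 ((StdForm.antidiagonal 2).over L)) : Subgroup (quasiSplit (↥(maximalRealSubfield L)) L (IsCMField.complexConj L) 2).Adelic), f (IdeleClassGroup.ideleNorm L x : ℝ) * (((χ x : ℂˣ) : ℂ) * φ (k : (quasiSplit (↥(maximalRealSubfield L)) L (IsCMField.complexConj L) 2).Adelic)) *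
                conj (f' (IdeleClassGroup.ideleNorm L x : ℝ) * (((χ' x : ℂˣ) : ℂ) * φ' (k : (quasiSplit (↥(maximalRealSubfield L)) L (IsCMField.complexConj L) 2).Adelic)) +
                  κN • ((((2 * π)⁻¹ : ℝ) : ℂ) * ∫ y : ℝ, mellin f' (-((σ₀ : ℂ) + y * I)) *
                    ((((IdeleClassGroup.ideleNorm L x : ℝ≥0) : ℝ) : ℂ) * ((((reflectChar (IsCMField.complexConj L) χ') x : ℂˣ) : ℂ) * ((((IdeleClassGroup.ideleNorm L x)⁻¹ : ℝ≥0) : ℝ) : ℂ) ^ ((σ₀ : ℂ) + y * I)) *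
                      ∫ v : ↥(adelicUnipotent (↥(maximalRealSubfield L)) L (IsCMField.complexConj L) 2), flatSectionU φ' ((σ₀ : ℂ) + y * I) (((quasiSplit (↥(maximalRealSubfield L)) L (IsCMField.complexConj L) 2).toAdelic (weylLongU ((IsCMField.complexConj L : L ≃ₐ[↥(maximalRealSubfield L)] L) : L →+* L) (rfl : (StdForm.antidiagonal 2).over L = (StdForm.antidiagonal 2).over L))) * ((v : (quasiSplit (↥(maximalRealSubfield L)) L (IsCMField.complexConj L) 2).Adelic) * (k : (quasiSplit (↥(maximalRealSubfield L)) L (IsCMField.complexConj L) 2).Adelic))) ∂ν))) ∂μK :=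
    (hBm.stronglyMeasurable.integral_prod_right' (ν := μK)).measurable
  -- (6) ★ (δ)₂, Bochner edition: `Ψ ↦ Φ` with the radial majorant `Φm = ‖f(‖·‖)‖·(C_φ·max(M₁,0))`
  have hΨN : ∀ (n : unipotentInBorel (↥(maximalRealSubfield L)) L (IsCMField.complexConj L) 2) (y : (quasiSplit (↥(maximalRealSubfield L)) L (IsCMField.complexConj L) 2).Adelic),
      Ψ (((n : borelAdelic (↥(maximalRealSubfield L)) L (IsCMField.complexConj L) 2) : (quasiSplit (↥(maximalRealSubfield L)) L (IsCMField.complexConj L) 2).Adelic) * y) = Ψ y := fun n y => by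
    have hn := (mem_unipotentInBorel_iff _).1 n.2
    simp only [hΨ, borelHeight_unipotent_mul hn, hφN _ hn y, hCTN _ hn y]
  have hΨB : ∀ b ∈ arithmeticBorel (↥(maximalRealSubfield L)) L (IsCMField.complexConj L) 2, ∀ y : (quasiSplit (↥(maximalRealSubfield L)) L (IsCMField.complexConj L) 2).Adelic, Ψ ((b : (quasiSplit (↥(maximalRealSubfield L)) L (IsCMField.complexConj L) 2).Adelic) * y) = Ψ y := fun b hb y => by
    simp only [hΨ, K2E1TruncatedEisensteinExplicit.borelHeight_arithmeticBorel_mul hb, hφB b hb y, hCTB b hb y]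
  have hfin : ∫⁻ x in 𝓕I, (((IdeleClassGroup.ideleNorm L x)⁻¹ : ℝ≥0) : ℝ≥0∞) * (‖f (IdeleClassGroup.ideleNorm L x : ℝ)‖ₑ * ENNReal.ofReal (Cφ * max M₁ 0)) ∂νI < ∞ := by
    rw [setLIntegral_inv_ideleNorm_mul_comp_eq νI h𝓕I (Gm := fun r => ‖f r‖ₑ * ENNReal.ofReal (Cφ * max M₁ 0)) (hf.continuous.measurable.enorm.mul_const _)]
    exact ENNReal.mul_lt_top hVt.lt_top (setLIntegral_inv_mul_inv_mul_enorm_lt_top hf.continuous hfs hf0 ENNReal.ofReal_ne_top)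
  obtain ⟨-, -, hδE⟩ := hδ β hβ Ψ hΨm hΨN hΨB (fun x : (AdeleRing (𝓞 L) L)ˣ => ∫ k : ((standardMaximalCompactGL 2 L).comap (adelicVal (↥(maximalRealSubfield L)) L (IsCMField.complexConj L) 2 ((StdForm.antidiagonal 2).over L)) : Subgroup (quasiSplit (↥(maximalRealSubfield L)) L (IsCMField.complexConj L) 2).Adelic), f (IdeleClassGroup.ideleNorm L x : ℝ) * (((χ x : ℂˣ) : ℂ) * φ (k : (quasiSplit (↥(maximalRealSubfield L)) L (IsCMField.complexConj L) 2).Adelic)) *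
                conj (f' (IdeleClassGroup.ideleNorm L x : ℝ) * (((χ' x : ℂˣ) : ℂ) * φ' (k : (quasiSplit (↥(maximalRealSubfield L)) L (IsCMField.complexConj L) 2).Adelic)) +
                  κN • ((((2 * π)⁻¹ : ℝ) : ℂ) * ∫ y : ℝ, mellin f' (-((σ₀ : ℂ) + y * I)) *
                    ((((IdeleClassGroup.ideleNorm L x : ℝ≥0) : ℝ) : ℂ) * ((((reflectChar (IsCMField.complexConj L) χ') x : ℂˣ) : ℂ) * ((((IdeleClassGroup.ideleNorm L x)⁻¹ : ℝ≥0) : ℝ) : ℂ) ^ ((σ₀ : ℂ) + y * I)) *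
                      ∫ v : ↥(adelicUnipotent (↥(maximalRealSubfield L)) L (IsCMField.complexConj L) 2), flatSectionU φ' ((σ₀ : ℂ) + y * I) (((quasiSplit (↥(maximalRealSubfield L)) L (IsCMField.complexConj L) 2).toAdelic (weylLongU ((IsCMField.complexConj L : L ≃ₐ[↥(maximalRealSubfield L)] L) : L →+* L) (rfl : (StdForm.antidiagonal 2).over L = (StdForm.antidiagonal 2).over L))) * ((v : (quasiSplit (↥(maximalRealSubfield L)) L (IsCMField.complexConj L) 2).Adelic) * (k : (quasiSplit (↥(maximalRealSubfield L)) L (IsCMField.complexConj L) 2).Adelic))) ∂ν))) ∂μK) hΦm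
    (fun k hk x => by
      simp only [map_mul, ideleNorm_principal hk, one_mul, HeckeCharacter.map_principal χ hk, HeckeCharacter.map_principal χ' hk,
        HeckeCharacter.map_principal (reflectChar (IsCMField.complexConj L) χ') hk])
    (fun t => by
      simp only [hΨ]
      refine integral_congr_ae (ae_of_all _ fun k => ?_)
      simp only [hCT, hHtk t k, apply_torus_mul_of_isChiSection hφ t, apply_torus_mul_of_isChiSection hφ' t,
        integral_flatSectionU_weylLongU_torus_mul_eq_diagUnit hc hc1 ν hφ' hφ'c.measurable t])
    (fun x => ‖f (IdeleClassGroup.ideleNorm L x : ℝ)‖ₑ * ENNReal.ofReal (Cφ * max M₁ 0)) ((hf.continuous.comp hIc).measurable.enorm.mul_const _)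
    (fun k hk x => by simp only [map_mul, ideleNorm_principal hk, one_mul])
    (fun t k => by
      simp only [hΨ]
      rw [enorm_mul, enorm_mul, hHtk t k, mul_assoc, ← ofReal_norm (φ _), ← ofReal_norm (conj _), ← ENNReal.ofReal_mul (norm_nonneg _), Complex.norm_conj]
      exact mul_le_mul' le_rfl (ENNReal.ofReal_le_ofReal (mul_le_mul (hφC _) (hCTb _) (norm_nonneg _) ((norm_nonneg (φ 1)).trans (hφC 1)))))
    hfin
  -- (7) assembly
  rw [hEq, hAVG, hΨeq, hδE]
  push_cast
  ring

end Head

end Summit.HodgeConjecture.HodgeConjecture.Cruxes.H413.K2E1ChiPseudoEisensteinIdeleLevelCMTwo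

end
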